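import Summits.Ventures.CertifiedArithmetic.LowPrec.GemmDyadicStep

/-!
# One `binary16` accumulation step on a dyadic grid, in integers, saturation included

HONEST FRAMING (venture CertifiedArithmetic / cell `pub-lowprec`, seat gemm, gen 10): certified error
envelopes and provably optimal rounding/accumulation schemes for low-precision formats under stated
cost models; every table by two implementations; no hardware or vendor claims.

Infrastructure for paper `gemm.tex` §Regimes (the θ-certificates with a `binary16` accumulator, first
the row E2M1²→binary16 of Prop. Θ(i)).  The bridges `GemmGridRounding*.lean` express `fl_bf16` on a
grid `2^-g` through the integer rounding `rne8` under a SIZE hypothesis (`|K| < 2^32 … 2^120`) that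
keeps the argument inside `bfloat16`'s huge range, where the cell's model `roundNE` never saturates.
A `binary16` accumulator is different: its largest finite value `65504` IS reached by sums of FP4
products, and `roundNE Format.Binary16` saturates there.  This file therefore gives a TOTAL bridge:
* `rneSigMag m n`: round-to-nearest-even of a natural number to `m + 1` significant bits (binade by
  `Nat.log2`; `m = 7` is `rne8Mag` of `GemmDyadicStep.lean`);
* `rneB16 g K`: the saturating version for `binary16` read on the grid `2^-g` — inputs of magnitude
  at least `65504 · 2^g` go to `±65504 · 2^g`, all others to `rneSigMag 10`;
* `toRat_roundNE_Binary16_grid`: `fl_binary16(K / 2^g) = rneB16 g K / 2^g` for EVERY integer `K` and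
  every `g ≤ 24` (`binary16`'s quantum is `2^-24`, so the grid has no subnormal effects; below
  `65504` the closed form `Format.rneGrid_of_pattern` applies, at and above it `roundNE` saturates,
  `abs_toRat_roundNE_of_maxRat_le`);
* the dictionary of `GemmThetaCertificate.lean` in grid units with no side condition:
  `flStep_binary16`, `gainOf_binary16`, `deficitOf_binary16`, and `exists_toRat_eq_rneB16`.
-/

namespace Literature.ComputerArithmetic.FloatingPoint

namespace MiniFloat

open Format

/-! ### Round-to-nearest-even to `m + 1` significant bits, and the saturating `binary16` version -/

/-- Magnitude part: `n < 2^(m+1)` is exact, else round the pattern `n` to `m + 1` bits in the binade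
`log₂ n - m`. [cite: IEEE7542019, §4.3.1] -/
def rneSigMag (m n : ℕ) : ℕ :=
  if n < 2 ^ (m + 1) then n else rneShiftNat n (Nat.log2 n - m) * 2 ^ (Nat.log2 n - m)

/-- SATURATING magnitude part for `binary16` on the grid `2^-g`: magnitudes at or above
`65504 · 2^g` (`= 4 · maxRat` in grid units for `g = 2`) go to `65504 · 2^g`, the others are rounded
to 11 significant bits. [cite: IEEE7542019, §4.3.1; saturation as in the cell's model `roundNE`] -/
def rneB16Mag (g n : ℕ) : ℕ :=
  if 65504 * 2 ^ g ≤ n then 65504 * 2 ^ g else rneSigMag 10 n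

/-- `rneB16 g K`: the value of `fl_binary16 (K / 2^g)` in grid units (sign kept, saturating):
`toRat_roundNE_Binary16_grid`. [cite: IEEE7542019, §4.3.1] -/
def rneB16 (g : ℕ) (K : ℤ) : ℤ :=
  if K < 0 then -((rneB16Mag g K.natAbs : ℕ) : ℤ) else ((rneB16Mag g K.natAbs : ℕ) : ℤ)

/-- `binary16` has 10 trailing significand bits. [cite: IEEE7542019, Table 3.5] -/
theorem Binary16_manBits : Format.Binary16.manBits = 10 := rfl

/-- `binary16` has quantum exponent `-24`. [cite: IEEE7542019, Table 3.5] -/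
theorem Binary16_qexp : Format.Binary16.qexp = -24 := by decide

/-- Integers below `2^11` in magnitude, read in units `2^-g` with `g ≤ 24`, are `binary16` values.
[folklore] -/
theorem exists_toRat_eq_Binary16_small {g : ℕ} (hg : g ≤ 24) {K : ℤ} (hK : K.natAbs < 2 ^ (10 + 1)) :
    ∃ y : MiniFloat Format.Binary16, y.toRat = (K : ℚ) / 2 ^ g := by
  have h2g : (0 : ℚ) < 2 ^ g := by positivity
  refine exists_toRat_eq_of_isFloat ⟨K, -(g : ℤ), ?_, by rw [Binary16_qexp]; omega, ?_⟩ ?_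
  · rw [Binary16_manBits]; rw [← Int.natCast_natAbs]; exact_mod_cast hK
  · rw [zpow_neg, zpow_natCast]; ring
  · rw [Binary16_maxRat.1, abs_div, abs_of_pos h2g, ← Int.cast_abs, ← Nat.cast_natAbs]
    have hlt : ((K.natAbs : ℕ) : ℚ) < 2 ^ (10 + 1) := by exact_mod_cast hK
    have h1 : (1 : ℚ) ≤ 2 ^ g := one_le_pow₀ (by norm_num)
    calc ((K.natAbs : ℕ) : ℚ) / 2 ^ g ≤ (K.natAbs : ℕ) := div_le_self (by positivity) h1
      _ ≤ 65504 := by norm_num at hlt ⊢; linarith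

/-- THE TOTAL BRIDGE on the grid `2^-g`, `g ≤ 24`: `fl_binary16(K / 2^g) = rneB16 g K / 2^g` for
every integer `K` — exact below `2^11`, the pattern rounding below `65504 · 2^g`
(`Format.rneGrid_of_pattern`), saturation at and above it (`abs_toRat_roundNE_of_maxRat_le`).
[folklore] -/
theorem toRat_roundNE_Binary16_grid {g : ℕ} (hg : g ≤ 24) (K : ℤ) :
    (roundNE Format.Binary16 ((K : ℚ) / 2 ^ g)).toRat = (rneB16 g K : ℚ) / 2 ^ g := by
  have h2g : (0 : ℚ) < 2 ^ g := by positivity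
  have habs : |(K : ℚ) / 2 ^ g| = (K.natAbs : ℚ) / 2 ^ g := by
    rw [abs_div, abs_of_pos h2g, Nat.cast_natAbs, Int.cast_abs]
  have hsgn : (K : ℚ) / 2 ^ g < 0 ↔ K < 0 := by
    rw [div_lt_iff₀ h2g, zero_mul]; norm_cast
  by_cases hsat : 65504 * 2 ^ g ≤ K.natAbs
  · -- saturation branch
    have hmax : Format.Binary16.maxRat ≤ |(K : ℚ) / 2 ^ g| := by
      rw [habs, Binary16_maxRat.1, le_div_iff₀ h2g]
      have : ((65504 * 2 ^ g : ℕ) : ℚ) ≤ ((K.natAbs : ℕ) : ℚ) := by exact_mod_cast hsat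
      push_cast at this; exact this
    have hA := abs_toRat_roundNE_of_maxRat_le hmax
    rw [Binary16_maxRat.1] at hA
    have hval := toRat_roundNE (φ := Format.Binary16) ((K : ℚ) / 2 ^ g)
    have hq : 0 < Format.Binary16.quantum := Format.quantum_pos _
    have hG : (0 : ℚ) ≤ (Format.Binary16.rneGrid (|(K : ℚ) / 2 ^ g| / Format.Binary16.quantum) : ℕ) :=
      Nat.cast_nonneg _
    unfold rneB16 rneB16Mag
    rw [if_pos hsat]
    by_cases hneg : K < 0
    · rw [if_pos hneg, if_pos (hsgn.mpr hneg)] at *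
      rw [hval] at hA ⊢
      have hle : -((Format.Binary16.rneGrid (|(K : ℚ) / 2 ^ g| / Format.Binary16.quantum) : ℕ) : ℚ)
          * Format.Binary16.quantum ≤ 0 := by nlinarith
      rw [abs_of_nonpos hle] at hA
      have e : -((Format.Binary16.rneGrid (|(K : ℚ) / 2 ^ g| / Format.Binary16.quantum) : ℕ) : ℚ)
          * Format.Binary16.quantum = -65504 := by linarith
      rw [e]; push_cast; field_simp
    · rw [if_neg hneg, if_neg (fun h => hneg (hsgn.mp h))] at *
      rw [hval] at hA ⊢
      have hle : (0 : ℚ) ≤ ((Format.Binary16.rneGrid (|(K : ℚ) / 2 ^ g| / Format.Binary16.quantum) : ℕ) : ℚ)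
          * Format.Binary16.quantum := by positivity
      rw [abs_of_nonneg hle] at hA
      rw [hA]; push_cast; field_simp
  · -- in range
    have hmax : |(K : ℚ) / 2 ^ g| ≤ Format.Binary16.maxRat := by
      rw [habs, Binary16_maxRat.1, div_le_iff₀ h2g]
      have : ((K.natAbs : ℕ) : ℚ) ≤ ((65504 * 2 ^ g : ℕ) : ℚ) := by exact_mod_cast (not_le.mp hsat).le
      push_cast at this; exact this
    by_cases hn : K.natAbs < 2 ^ (10 + 1)
    · -- exact branch
      rw [toRat_roundNE_of_exists (exists_toRat_eq_Binary16_small hg hn)]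
      unfold rneB16 rneB16Mag rneSigMag
      rw [if_neg hsat, if_pos hn]
      have : (if K < 0 then -((K.natAbs : ℕ) : ℤ) else ((K.natAbs : ℕ) : ℤ)) = K := by
        split_ifs with h <;> omega
      rw [this]
    · -- pattern branch
      have hn0 : K.natAbs ≠ 0 := by intro h; rw [h] at hn; norm_num at hn
      have hA : 2 ^ Nat.log2 K.natAbs ≤ K.natAbs := Nat.log2_self_le hn0
      have hB : K.natAbs < 2 ^ (Nat.log2 K.natAbs + 1) := Nat.lt_log2_self
      have h10 : 10 ≤ Nat.log2 K.natAbs := by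
        by_contra hc
        have := Nat.pow_le_pow_right (by norm_num : 0 < 2)
          (show Nat.log2 K.natAbs + 1 ≤ 10 + 1 by omega)
        omega
      set k := Nat.log2 K.natAbs - 10 with hk
      set d := 24 - g with hd
      have hlk : Nat.log2 K.natAbs = 10 + k := by omega
      have hlo : 2 ^ (Format.Binary16.manBits + k) ≤ K.natAbs := by
        rw [Binary16_manBits, ← hlk]; exact hA
      have hhi : K.natAbs < 2 ^ (Format.Binary16.manBits + k + 1) := by
        rw [Binary16_manBits, ← hlk]; exact hB
      have hq2 : Format.Binary16.quantum = 1 / 2 ^ 24 := Binary16_maxRat.2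
      have h24 : (2 : ℚ) ^ 24 = 2 ^ d * 2 ^ g := by rw [← pow_add, hd, Nat.sub_add_cancel hg]
      have hx : |(K : ℚ) / 2 ^ g|
          = (K.natAbs : ℚ) * 2 ^ (d + k) / 2 ^ k * Format.Binary16.quantum := by
        rw [habs, hq2, h24, pow_add]; field_simp
      have hgrid := Format.rneGrid_of_pattern hlo hhi (pattern_le_maxScaled hx hmax)
      rw [rneInt_natCast_div_two_pow, Int.cast_natCast] at hgrid
      rw [toRat_roundNE, scaledInput_of_pattern hx]
      unfold rneB16 rneB16Mag rneSigMag
      rw [if_neg hsat, if_neg hn, ← hk]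
      simp only [hsgn]
      split_ifs with hneg
      · rw [neg_mul, hgrid, hq2, h24]; push_cast; rw [pow_add]; field_simp
      · rw [hgrid, hq2, h24]; push_cast; rw [pow_add]; field_simp

/-- A grid value `rneB16 g K / 2^g` is a `binary16` value (it is a rounding). [folklore] -/
theorem exists_toRat_eq_rneB16 {g : ℕ} (hg : g ≤ 24) (K : ℤ) :
    ∃ y : MiniFloat Format.Binary16, y.toRat = (rneB16 g K : ℚ) / 2 ^ g :=
  ⟨_, toRat_roundNE_Binary16_grid hg K⟩

/-! ### One step, gain and deficit in grid units -/

/-- `fl_binary16(V/2^g + Q/2^g) = rneB16 g (V + Q)/2^g`, no side condition. [cell] -/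
theorem flStep_binary16 {g : ℕ} (hg : g ≤ 24) (V Q : ℤ) :
    flStep Format.Binary16 ((V : ℚ) / 2 ^ g) ((Q : ℚ) / 2 ^ g) = (rneB16 g (V + Q) : ℚ) / 2 ^ g := by
  unfold flStep
  rw [show (V : ℚ) / 2 ^ g + (Q : ℚ) / 2 ^ g = ((V + Q : ℤ) : ℚ) / 2 ^ g by push_cast; ring]
  exact toRat_roundNE_Binary16_grid hg (V + Q)

/-- The gain of a `binary16` step in grid units. [cell] -/
theorem gainOf_binary16 {g : ℕ} (hg : g ≤ 24) (V Q : ℤ) :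
    gainOf Format.Binary16 ((V : ℚ) / 2 ^ g) ((Q : ℚ) / 2 ^ g)
      = ((rneB16 g (V + Q) - V - Q : ℤ) : ℚ) / 2 ^ g := by
  unfold gainOf; rw [flStep_binary16 hg]; push_cast; ring

/-- The deficit of a `binary16` step in grid units. [cell] -/
theorem deficitOf_binary16 {g : ℕ} (hg : g ≤ 24) (V Q : ℤ) :
    deficitOf Format.Binary16 ((V : ℚ) / 2 ^ g) ((Q : ℚ) / 2 ^ g)
      = (((Q.natAbs : ℤ) - (rneB16 g (V + Q) - V - Q) : ℤ) : ℚ) / 2 ^ g := by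
  unfold deficitOf
  rw [gainOf_binary16 hg, abs_div, abs_of_pos (by positivity : (0 : ℚ) < 2 ^ g), ← Int.cast_abs,
    ← Int.natCast_natAbs]
  push_cast; ring

/-- Sanity values on the quarter grid (`g = 2`): `65504 - 32 + 36 ↦ 65504` (a paid move into the
top value), `65504 + 9 ↦ 65504` and `65504 + 36 ↦ 65504` (saturating absorptions), `-(65504 + 16) ↦
-65504`, `8208 + ¼ ↦ 8208` (`θ`'s capacity letter is absorbed), `512 + ¼ ↦ 512`, `511¾` exact.
[cell, kernel-checked] -/
theorem rneB16_values :
    rneB16 2 (4 * 65472 + 144) = 4 * 65504 ∧ rneB16 2 (4 * 65504 + 36) = 4 * 65504 ∧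
    rneB16 2 (4 * 65504 + 144) = 4 * 65504 ∧ rneB16 2 (-(4 * 65504 + 64)) = -(4 * 65504) ∧
    rneB16 2 (4 * 8208 + 1) = 4 * 8208 ∧ rneB16 2 (4 * 512 + 1) = 4 * 512 ∧
    rneB16 2 (4 * 512 - 1) = 4 * 512 - 1 := by
  decide +kernel

end MiniFloat

end Literature.ComputerArithmetic.FloatingPoint
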